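import Summits.Ventures.PercRepro.ThetaSigmaDenseMain

/-!
# (Ω): the twice-coloured form of (Σ)

Dossier proofs/MINE1-theoremS.md, Addendum 80 (mine-1, gen 41). A **twice-coloured family** is a
family `F` of subsets of a ground set `U` together with two colourings `c0 c1 : Finset α → Bool`
(only their values on the members matter). Its **`A`-family** `omegaA F c0 c1` consists of the
meets `s ⊓ t` of distinct members with `c0 s = c0 t` and the differences `s \ t` of members
(`s = t` allowed) with `c0 s = c1 t`; its **`C`-family** `omegaC U F c1` consists of the relative
co-joins `U \ (s ⊔ t)` of distinct members with `c1 s = c1 t`; the **(Ω)-count** is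
`omegaCount U F c0 c1 = |omegaA F c0 c1| + |omegaC U F c1|`.

**Conjecture (Ω)** (`ConjOmega α`): `|F| ≤ omegaCount U F c0 c1` for every family `F ⊆ 𝒫(U)` with
at least three members and every pair of colourings. (With two members the bound can fail by one:
two members `s, t` with `c0 s = c1 s ≠ c0 t = c1 t` have `A = {∅}`, `C = ∅`.)

(Ω) contains (Σ): for a valid (Σ)-instance `X` on `U` and a point `p ∈ U`, the family
`sigmaOmegaFam U p X` of the `p`-free members together with the relative complements `U \ x` of
the `p`-members, coloured by `c0 s = [s ∉ X]`, `c1 s = [s ∈ X]`, has its `A`-family inside the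
`p`-free part of `sigmaD U X` and its `C`-family (relative to `U \ {p}`) inside the `p`-part with
`p` removed; so `|sigmaD U X| ≥ omegaCount ≥ |F| = |X|` (`card_le_card_sigmaD_of_conjOmega`,
`conjSigma_of_conjOmega`). The point of the reformulation is that the ground-set induction of
`ThetaSigmaSepMain.lean` has an exact credit lemma in this language (`ThetaOmegaSplit.lean`).

* `mem_omegaA`, `mem_omegaC`, `inf_mem_omegaA`, `sdiff_mem_omegaA`, `sdiff_sup_mem_omegaC` —
  membership;
* `sigmaOmegaFam`, `mem_sigmaOmegaFam`, `card_sigmaOmegaFam` — the family of a (Σ)-instance at a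
  point has exactly `|X|` members (validity);
* `omegaA_sigmaOmegaFam_subset`, `omegaC_sigmaOmegaFam_subset` — the two halves lie in the two
  parts of `sigmaD U X`;
* `card_le_card_sigmaD_of_conjOmega`, `conjSigma_of_conjOmega` — **(Ω) implies (Σ)**.
-/

namespace PercRepro.MSTight

open Finset

variable {α : Type*} [DecidableEq α]

section OmegaDefs

/-- **The `A`-family of a twice-coloured family**: the meets `s ⊓ t` of distinct members with
`c0 s = c0 t`, and the differences `s \ t` of (not necessarily distinct) members with `c0 s = c1 t`. -/
def omegaA (F : Finset (Finset α)) (c0 c1 : Finset α → Bool) : Finset (Finset α) :=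
  (F.offDiag.filter fun p => c0 p.1 = c0 p.2).image (fun p => p.1 ⊓ p.2) ∪
    ((F ×ˢ F).filter fun p => c0 p.1 = c1 p.2).image fun p => p.1 \ p.2

/-- **The `C`-family of a twice-coloured family** relative to `U`: the relative co-joins
`U \ (s ⊔ t)` of distinct members with `c1 s = c1 t`. -/
def omegaC (U : Finset α) (F : Finset (Finset α)) (c1 : Finset α → Bool) : Finset (Finset α) :=
  (F.offDiag.filter fun p => c1 p.1 = c1 p.2).image fun p => U \ (p.1 ⊔ p.2)

/-- **The (Ω)-count**: the two families counted separately. -/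
def omegaCount (U : Finset α) (F : Finset (Finset α)) (c0 c1 : Finset α → Bool) : ℕ :=
  (omegaA F c0 c1).card + (omegaC U F c1).card

/-- **Conjecture (Ω)**: every twice-coloured family of at least three subsets of a ground set `U`
has `|F| ≤ omegaCount U F c0 c1` (Addendum 80; exhaustive on ≤ 3 points for every family and every
pair of colourings, on 4 points for `|F| ≤ 6`, random to 7 points). -/
def ConjOmega (α : Type*) [DecidableEq α] : Prop :=
  ∀ (U : Finset α) (F : Finset (Finset α)) (c0 c1 : Finset α → Bool),
    (∀ s ∈ F, s ⊆ U) → 3 ≤ F.card → F.card ≤ omegaCount U F c0 c1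

variable {U : Finset α} {F : Finset (Finset α)} {c0 c1 : Finset α → Bool}

/-- Membership in the `A`-family. -/
theorem mem_omegaA {E : Finset α} :
    E ∈ omegaA F c0 c1 ↔
      (∃ s ∈ F, ∃ t ∈ F, s ≠ t ∧ c0 s = c0 t ∧ s ⊓ t = E) ∨
        ∃ s ∈ F, ∃ t ∈ F, c0 s = c1 t ∧ s \ t = E := by
  unfold omegaA
  simp only [mem_union, mem_image, mem_filter, mem_offDiag, mem_product, Prod.exists]
  constructor
  · rintro (⟨s, t, ⟨⟨hs, ht, hst⟩, hc⟩, h⟩ | ⟨s, t, ⟨⟨hs, ht⟩, hc⟩, h⟩)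
    · exact Or.inl ⟨s, hs, t, ht, hst, hc, h⟩
    · exact Or.inr ⟨s, hs, t, ht, hc, h⟩
  · rintro (⟨s, hs, t, ht, hst, hc, h⟩ | ⟨s, hs, t, ht, hc, h⟩)
    · exact Or.inl ⟨s, t, ⟨⟨hs, ht, hst⟩, hc⟩, h⟩
    · exact Or.inr ⟨s, t, ⟨⟨hs, ht⟩, hc⟩, h⟩

/-- Membership in the `C`-family. -/
theorem mem_omegaC {E : Finset α} :
    E ∈ omegaC U F c1 ↔ ∃ s ∈ F, ∃ t ∈ F, s ≠ t ∧ c1 s = c1 t ∧ U \ (s ⊔ t) = E := by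
  unfold omegaC
  simp only [mem_image, mem_filter, mem_offDiag, Prod.exists]
  constructor
  · rintro ⟨s, t, ⟨⟨hs, ht, hst⟩, hc⟩, h⟩
    exact ⟨s, hs, t, ht, hst, hc, h⟩
  · rintro ⟨s, hs, t, ht, hst, hc, h⟩
    exact ⟨s, t, ⟨⟨hs, ht, hst⟩, hc⟩, h⟩

/-- The meet of two distinct members of the same `c0`-colour is in the `A`-family. -/
theorem inf_mem_omegaA {s t : Finset α} (hst : s ≠ t) (hs : s ∈ F) (ht : t ∈ F)
    (hc : c0 s = c0 t) : s ⊓ t ∈ omegaA F c0 c1 :=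
  mem_omegaA.2 (Or.inl ⟨s, hs, t, ht, hst, hc, rfl⟩)

/-- The difference `s \ t` of two members with `c0 s = c1 t` is in the `A`-family. -/
theorem sdiff_mem_omegaA {s t : Finset α} (hs : s ∈ F) (ht : t ∈ F) (hc : c0 s = c1 t) :
    s \ t ∈ omegaA F c0 c1 :=
  mem_omegaA.2 (Or.inr ⟨s, hs, t, ht, hc, rfl⟩)

/-- The relative co-join of two distinct members of the same `c1`-colour is in the `C`-family. -/
theorem sdiff_sup_mem_omegaC {s t : Finset α} (hst : s ≠ t) (hs : s ∈ F) (ht : t ∈ F)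
    (hc : c1 s = c1 t) : U \ (s ⊔ t) ∈ omegaC U F c1 :=
  mem_omegaC.2 ⟨s, hs, t, ht, hst, hc, rfl⟩

/-- Every member of the `C`-family is a subset of `U`. -/
theorem subset_of_mem_omegaC {E : Finset α} (hE : E ∈ omegaC U F c1) : E ⊆ U := by
  obtain ⟨s, -, t, -, -, -, rfl⟩ := mem_omegaC.1 hE
  exact sdiff_subset

/-- The (Ω)-count is symmetric under a global swap of the two colours. -/
theorem omegaCount_not (U : Finset α) (F : Finset (Finset α)) (c0 c1 : Finset α → Bool) :
    omegaCount U F (fun s => !c0 s) (fun s => !c1 s) = omegaCount U F c0 c1 := by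
  have hA : omegaA F (fun s => !c0 s) (fun s => !c1 s) = omegaA F c0 c1 := by
    ext E
    simp only [mem_omegaA, Bool.not_inj_iff]
  have hC : omegaC U F (fun s => !c1 s) = omegaC U F c1 := by
    ext E
    simp only [mem_omegaC, Bool.not_inj_iff]
  unfold omegaCount
  rw [hA, hC]

end OmegaDefs

section SigmaBridge

variable {U : Finset α} {X : Finset (Finset α)} {p : α}

/-- **The twice-coloured family of a (Σ)-instance at a point `p`**: the `p`-free members together
with the relative complements `U \ x` of the `p`-members (a family of subsets of `U \ {p}`). -/
def sigmaOmegaFam (U : Finset α) (p : α) (X : Finset (Finset α)) : Finset (Finset α) :=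
  (X.filter fun x => p ∉ x) ∪ (X.filter fun x => p ∈ x).image fun x => U \ x

/-- The first colouring of the family of a (Σ)-instance: `true` exactly on the complements. -/
def sigmaC0 (X : Finset (Finset α)) : Finset α → Bool := fun s => decide (s ∉ X)

/-- The second colouring of the family of a (Σ)-instance: `true` exactly on the members of `X`. -/
def sigmaC1 (X : Finset (Finset α)) : Finset α → Bool := fun s => decide (s ∈ X)

/-- Membership in the family of a (Σ)-instance at `p`. -/
theorem mem_sigmaOmegaFam {s : Finset α} :
    s ∈ sigmaOmegaFam U p X ↔ (s ∈ X ∧ p ∉ s) ∨ ∃ x ∈ X, p ∈ x ∧ U \ x = s := by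
  unfold sigmaOmegaFam
  simp only [mem_union, mem_filter, mem_image]
  constructor
  · rintro (h | ⟨x, ⟨hx, hpx⟩, h⟩)
    · exact Or.inl h
    · exact Or.inr ⟨x, hx, hpx, h⟩
  · rintro (h | ⟨x, hx, hpx, h⟩)
    · exact Or.inl h
    · exact Or.inr ⟨x, ⟨hx, hpx⟩, h⟩

/-- A relative complement of a member is never a member (validity). -/
theorem sdiff_notMem_of_valid (hv : SigmaValidRel U X) {x : Finset α} (hx : x ∈ X) :
    U \ x ∉ X :=
  sdiff_notMem_of_sigmaValidRel hv hx

/-- The members of the family of a valid instance at `p ∈ U` are subsets of `U \ {p}`. -/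
theorem subset_erase_of_mem_sigmaOmegaFam (hv : SigmaValidRel U X) {s : Finset α}
    (hs : s ∈ sigmaOmegaFam U p X) : s ⊆ U.erase p := by
  rcases mem_sigmaOmegaFam.1 hs with ⟨hsX, hps⟩ | ⟨x, -, hpx, rfl⟩
  · intro a ha
    exact mem_erase.2 ⟨fun h => hps (h ▸ ha), hv.1 s hsX ha⟩
  · intro a ha
    rw [mem_sdiff] at ha
    exact mem_erase.2 ⟨fun h => ha.2 (h ▸ hpx), ha.1⟩

/-- The family of a valid instance at a point has exactly `|X|` members: the `p`-free members and
the complements of the `p`-members are disjoint (validity) and the complement map is injective on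
subsets of `U`. -/
theorem card_sigmaOmegaFam (hv : SigmaValidRel U X) : (sigmaOmegaFam U p X).card = X.card := by
  unfold sigmaOmegaFam
  have hdisj : Disjoint (X.filter fun x => p ∉ x)
      ((X.filter fun x => p ∈ x).image fun x => U \ x) := by
    rw [disjoint_left]
    intro s hs hs'
    obtain ⟨x, hx, rfl⟩ := mem_image.1 hs'
    exact sdiff_notMem_of_valid hv (mem_filter.1 hx).1 (mem_filter.1 hs).1
  rw [card_union_of_disjoint hdisj, card_image_of_injOn]
  · rw [add_comm]
    exact card_filter_add_card_filter_not (s := X) (fun x => p ∈ x)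
  · intro x hx y hy hxy
    have hx' := hv.1 x (mem_filter.1 (mem_coe.1 hx)).1
    have hy' := hv.1 y (mem_filter.1 (mem_coe.1 hy)).1
    dsimp only at hxy
    rw [← Finset.sdiff_sdiff_eq_self hx', hxy, Finset.sdiff_sdiff_eq_self hy']

/-- **The `A`-family lies in the `p`-free part of `sigmaD U X`.** -/
theorem omegaA_sigmaOmegaFam_subset (hv : SigmaValidRel U X) :
    omegaA (sigmaOmegaFam U p X) (sigmaC0 X) (sigmaC1 X) ⊆ (sigmaD U X).filter fun d => p ∉ d := by
  intro E hE
  rw [mem_filter]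
  rcases mem_omegaA.1 hE with ⟨s, hs, t, ht, hst, hc, rfl⟩ | ⟨s, hs, t, ht, hc, rfl⟩
  · -- a meet of two distinct members of the same `c0`-colour
    rcases mem_sigmaOmegaFam.1 hs with ⟨hsX, hps⟩ | ⟨x, hx, hpx, rfl⟩ <;>
      rcases mem_sigmaOmegaFam.1 ht with ⟨htX, hpt⟩ | ⟨y, hy, hpy, rfl⟩
    · refine ⟨inf_mem_sigmaD hst hsX htX, ?_⟩
      simp only [inf_eq_inter, mem_inter, not_and]
      exact fun h => absurd h hps
    · -- colours differ: `s ∈ X`, `U \ y ∉ X`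
      exfalso
      simp only [sigmaC0, decide_eq_decide] at hc
      exact hc.2 (sdiff_notMem_of_valid hv hy) hsX
    · exfalso
      simp only [sigmaC0, decide_eq_decide] at hc
      exact hc.1 (sdiff_notMem_of_valid hv hx) htX
    · have hxy : x ≠ y := fun h => hst (h ▸ rfl)
      have hmem := sdiff_sup_mem_sigmaD (U := U) hxy hx hy
      refine ⟨?_, ?_⟩
      · have : U \ x ⊓ (U \ y) = U \ (x ⊔ y) := by
          rw [inf_eq_inter, sup_eq_union, sdiff_union_distrib]
        rwa [this]
      · simp only [inf_eq_inter, mem_inter, mem_sdiff, not_and]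
        exact fun h => absurd hpx h.2
  · -- a difference `s \ t` with `c0 s = c1 t`
    rcases mem_sigmaOmegaFam.1 hs with ⟨hsX, hps⟩ | ⟨x, hx, hpx, rfl⟩ <;>
      rcases mem_sigmaOmegaFam.1 ht with ⟨htX, hpt⟩ | ⟨y, hy, hpy, rfl⟩
    · -- `c0 s = false ≠ true = c1 t`
      exfalso
      simp only [sigmaC0, sigmaC1, decide_eq_decide] at hc
      exact hc.2 htX hsX
    · -- `s ∈ X`, `t = U \ y`: `s \ (U \ y) = s ⊓ y`
      have hsy : s ≠ y := fun h => hps (by rw [h]; exact hpy)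
      refine ⟨?_, ?_⟩
      · have hsU := hv.1 s hsX
        have : s \ (U \ y) = s ⊓ y := by
          ext a
          simp only [mem_sdiff, inf_eq_inter, mem_inter, not_and, not_not]
          exact ⟨fun h => ⟨h.1, h.2 (hsU h.1)⟩, fun h => ⟨h.1, fun _ => h.2⟩⟩
        rw [this]
        exact inf_mem_sigmaD hsy hsX hy
      · simp only [mem_sdiff, not_and]
        exact fun h => absurd h hps
    · -- `s = U \ x`, `t ∈ X`: `(U \ x) \ t = U \ (x ⊔ t)`
      have hxt : x ≠ t := fun h => hpt (by rw [← h]; exact hpx)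
      refine ⟨?_, ?_⟩
      · have : (U \ x) \ t = U \ (x ⊔ t) := by
          ext a
          simp only [mem_sdiff, sup_eq_union, mem_union, not_or]
          exact ⟨fun h => ⟨h.1.1, h.1.2, h.2⟩, fun h => ⟨⟨h.1, h.2.1⟩, h.2.2⟩⟩
        rw [this]
        exact sdiff_sup_mem_sigmaD hxt hx htX
      · simp only [mem_sdiff, not_and]
        exact fun h => absurd hpx h.2
    · -- `c0 (U \ x) = true ≠ false = c1 (U \ y)`
      exfalso
      simp only [sigmaC0, sigmaC1, decide_eq_decide] at hc
      exact sdiff_notMem_of_valid hv hy (hc.1 (sdiff_notMem_of_valid hv hx))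

/-- **The `C`-family (relative to `U \ {p}`), with `p` put back, lies in the `p`-part of
`sigmaD U X`.** -/
theorem omegaC_sigmaOmegaFam_subset (hv : SigmaValidRel U X) (hp : p ∈ U) :
    (omegaC (U.erase p) (sigmaOmegaFam U p X) (sigmaC1 X)).image (insert p) ⊆
      (sigmaD U X).filter fun d => p ∈ d := by
  intro E hE
  obtain ⟨d, hd, rfl⟩ := mem_image.1 hE
  rw [mem_filter]
  refine ⟨?_, mem_insert_self p d⟩
  obtain ⟨s, hs, t, ht, hst, hc, rfl⟩ := mem_omegaC.1 hd
  rcases mem_sigmaOmegaFam.1 hs with ⟨hsX, hps⟩ | ⟨x, hx, hpx, rfl⟩ <;>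
    rcases mem_sigmaOmegaFam.1 ht with ⟨htX, hpt⟩ | ⟨y, hy, hpy, rfl⟩
  · -- two `p`-free members: the co-join `U \ (s ⊔ t)` contains `p`
    have : insert p (U.erase p \ (s ⊔ t)) = U \ (s ⊔ t) := by
      ext a
      simp only [mem_insert, mem_sdiff, mem_erase, sup_eq_union, mem_union]
      constructor
      · rintro (rfl | ⟨⟨-, ha⟩, h⟩)
        · exact ⟨hp, fun h => h.elim hps hpt⟩
        · exact ⟨ha, h⟩
      · rintro ⟨ha, h⟩
        by_cases hap : a = p
        · exact Or.inl hap
        · exact Or.inr ⟨⟨hap, ha⟩, h⟩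
    rw [this]
    exact sdiff_sup_mem_sigmaD hst hsX htX
  · exfalso
    simp only [sigmaC1, decide_eq_decide] at hc
    exact sdiff_notMem_of_valid hv hy (hc.1 hsX)
  · exfalso
    simp only [sigmaC1, decide_eq_decide] at hc
    exact sdiff_notMem_of_valid hv hx (hc.2 htX)
  · -- two complements: `U.erase p \ ((U \ x) ⊔ (U \ y))` is `(x ⊓ y).erase p`
    have hxy : x ≠ y := fun h => hst (h ▸ rfl)
    have hxU := hv.1 x hx
    have hyU := hv.1 y hy
    have : insert p (U.erase p \ (U \ x ⊔ U \ y)) = x ⊓ y := by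
      ext a
      simp only [mem_insert, mem_sdiff, mem_erase, sup_eq_union, mem_union, inf_eq_inter,
        mem_inter, not_or, not_and, not_not]
      constructor
      · rintro (rfl | ⟨⟨-, haU⟩, hx', hy'⟩)
        · exact ⟨hpx, hpy⟩
        · exact ⟨hx' haU, hy' haU⟩
      · rintro ⟨hax, hay⟩
        by_cases hap : a = p
        · exact Or.inl hap
        · exact Or.inr ⟨⟨hap, hxU hax⟩, fun _ => hax, fun _ => hay⟩
    rw [this]
    exact inf_mem_sigmaD hxy hx hy

/-- **(Ω) gives (Σ) at every instance with at least three members**, relative to any ground set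
`U` with a point: `|X| ≤ |sigmaD U X|`. -/
theorem card_le_card_sigmaD_of_conjOmega (hΩ : ConjOmega α) (hv : SigmaValidRel U X) (hp : p ∈ U)
    (h3 : 3 ≤ X.card) : X.card ≤ (sigmaD U X).card := by
  set F := sigmaOmegaFam U p X with hF
  have hsub : ∀ s ∈ F, s ⊆ U.erase p := fun s hs => subset_erase_of_mem_sigmaOmegaFam hv hs
  have hcard : F.card = X.card := card_sigmaOmegaFam hv
  have hΩF := hΩ (U.erase p) F (sigmaC0 X) (sigmaC1 X) hsub (hcard ▸ h3)
  -- the two parts of `sigmaD U X`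
  have hsplit := card_filter_add_card_filter_not (s := sigmaD U X) (fun d => p ∈ d)
  have hA : (omegaA F (sigmaC0 X) (sigmaC1 X)).card ≤
      ((sigmaD U X).filter fun d => ¬ p ∈ d).card :=
    card_le_card (omegaA_sigmaOmegaFam_subset hv)
  have hC : (omegaC (U.erase p) F (sigmaC1 X)).card ≤ ((sigmaD U X).filter fun d => p ∈ d).card := by
    have hinj : Set.InjOn (insert p) (omegaC (U.erase p) F (sigmaC1 X) : Set (Finset α)) := by
      intro d hd e he hde
      have hpd : p ∉ d := fun h => (mem_erase.1 (subset_of_mem_omegaC (mem_coe.1 hd) h)).1 rfl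
      have hpe : p ∉ e := fun h => (mem_erase.1 (subset_of_mem_omegaC (mem_coe.1 he) h)).1 rfl
      rw [← erase_insert hpd, hde, erase_insert hpe]
    calc (omegaC (U.erase p) F (sigmaC1 X)).card
        = ((omegaC (U.erase p) F (sigmaC1 X)).image (insert p)).card :=
          (card_image_of_injOn hinj).symm
      _ ≤ _ := card_le_card (omegaC_sigmaOmegaFam_subset hv hp)
  unfold omegaCount at hΩF
  omega

/-- **(Ω) implies (Σ)** (`ConjSigma α`): instances with at most two members are direct, the others
go through the family at a point (a (Σ)-instance with three members needs a point of the ground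
set). -/
theorem conjSigma_of_conjOmega [Fintype α] (hΩ : ConjOmega α) : ConjSigma α := by
  intro X hv
  by_cases h3 : 3 ≤ X.card
  · -- the ground set has a point: otherwise `X ⊆ {∅}` has at most one member
    obtain ⟨p, hp⟩ : (univ : Finset α).Nonempty := by
      by_contra h
      rw [not_nonempty_iff_eq_empty] at h
      have : X ⊆ {∅} := by
        intro x hx
        have := hv.1 x hx
        rw [h, subset_empty] at this
        rw [this]
        exact mem_singleton_self _
      have := card_le_card this
      simp at this
      omega
    exact card_le_card_sigmaD_of_conjOmega hΩ hv hp h3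
  · rcases Nat.lt_or_ge X.card 2 with h2 | h2
    · exact le_trans (Nat.le_of_lt_succ h2) (card_pos.2 ⟨∅, empty_mem_sigmaD _ _⟩)
    · have : X.card = 2 := by omega
      exact this ▸ two_le_card_sigmaD_of_card_eq_two hv this

end SigmaBridge

end PercRepro.MSTight
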